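/-
Copyright (c) 2026 the pub-hodgecm-mathlib formalisation cell (harness21).  Prover seat hodgecm-mathlib-R90-C10-p02 (g2) (R90-TF SLAB, section S1 «Ch. 12 local»,
surplus hand on S1's last socket A2′ `stub_R90_122_keysThmTwo_ramifiedCharOne` = the K2E3 leaf (U4f-χ₁-ram-one), RULING R-S1-4; dealer of record K2E3-plan (g5)),
Track B «K2-LIT» ∕ h413 = `stmt-HodgeConjecture-24833`, line `K2_E3_EllipticInputs`, unit U4 «Keys», PART «U4Keys» socket :182 (U4f-χ₁-ram-one-pos)
`sig_K2E3KeysThmTwoContractingRamifiedCharOnePosDepth` (programme A_pos^{=} of K2E3-p37 (g0), memo `K2/K2E3-p37/g0/CENSUS-U4f-PosDepth.K2E3-p37-g0.md` §6–§10):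
brick §10 (b) «CM DRESS OF THE DEPTH WITNESSES» — the letter `hwit` of the cell-family engine on every INTERMEDIATE cell of `U(Φ₃)(L⁺_v)`.  REPORT-FIRST 2026-09-04.
-/
import Summits.HodgeConjecture.HodgeConjecture.Theorems.K2E3LevelNDepthWitnessCover        -- ★ §10 (a) (R90-C10-p01 (g2)): `exists_depth_witness_of_not_mem` (families X ∪ Z, model level); brings ★ p862033 X, ★ p861978 Z, ★ p861548 (`J_n` test)
import Summits.HodgeConjecture.HodgeConjecture.Theorems.K2E3LevelNIwahoriCharacterCM       -- ★ p861880 (K2E3-p37): the (G3) frame + `gn hgn Jn hJn`, `isUnit_apply_zero_zero_of_mem_pow`, letter `hcond`; brings ★ Z2A-3b `K2E3DepthZeroIwahoriCharacterCM` (`coe_eA_apply`, `isUnit_of_apply_ne_zero`, `map_mem_map_of_mem_map`)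
import Summits.HodgeConjecture.HodgeConjecture.Theorems.K2E3BranchATorusWitnessCM           -- ★ Z2A-3c (ii) (K2E3-p06): `twist_comp_proj_apply_one` (unfolding the inducing representation at a point); the depth-zero template `exists_torusWitness`
import Summits.HodgeConjecture.HodgeConjecture.Theorems.F0P2nBorelCharactersUnipotent      -- ★ (F0P2): `rootDeltaChar_cmBorel_eq_one` (`δ_B^{1∕2} = 1` on `N(L⁺_v)`)
import Literature.NumberTheory.Automorphic.AnisotropicUnitaryGroupCompactOfPlace            -- ★ `conjLocal_apply_eq_of_smul_eq` (`(c ⊗ 1)(y)_w = σ_w(y_w)` at a non-split place)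
import HarnessLib

/-!
# K2 ∕ E3 «EllipticInputs», unit U4 «Keys» — (U4f-χ₁-ram-one-pos), programme A_pos^{=} brick §10 (b): THE DEPTH WITNESSES IN CM DRESS
# «for `r ∈ N̄(L⁺_v)` off the big cell (`|(eA r)₂₀|_w < 1`) and off `J_{m+1}`: `∃ b₀ ∈ J_{m+1}`, `r b₀ r⁻¹ ∈ P`, `θ(b₀) ≠ ((χ∘proj) ⊗ δ^{1∕2})(r b₀ r⁻¹)·1`»
# [Roche1998 §4; Casselman1995 §6.3–§6.4; Rogawski1990 §1.10, §12.1; MoyPrasad1996 §3]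

Cell hodgecm-mathlib, Track B «K2-LIT», crux item H413 = stmt-HodgeConjecture-24833 (route `HCCMUnconditional`, no route verbs); target BY NAME the OPEN tier-0 leaf
`…K2E3EllipticInputs.U4Keys.sig_K2E3KeysThmTwoContractingRamifiedCharOnePosDepth` (U4Keys ED. 8 :182), design D-I «vanishing functional» at POSITIVE depth, sub-case A_pos^{=}
(cond(`χ₁|_{F^×}`) = cond `χ₁` = `m + 1`, `|2|_w = 1`).  Author R90-C10-p02 (g2) (S1 surplus hand; KNOCK 2026-09-04T16:40:31Z, R90-C10-plan (g0) «=» 16:41:51Z, dealer of record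
K2E3-plan (g5)).  `--supports stmt-HodgeConjecture-24833 --as helper`; THEOREMS ONLY; (G3)-EXPLICIT frame of ★ p861880 `K2E3LevelNIwahoriCharacterCM`
(`L v w hw eA heA ϖ hϖ K0 hK0` + the level letters `gn hgn Jn hJn` at exponent `m + 1`) + `w₀ hw₀` of ★ Z2A-3c.  NOT THE PAYER of :182 — item (b) of K2E3-p37's «REMAINING» list (§10);
item (c) the assembly `false_of_reducible_of_posDepth_of_normChar_ne_one` (K2E3-p34 (g2), hypothesis-first over THIS head) stays open.

THE POINT.  The cell-family engine ★ p861573 `K2E3BranchAContradictionCells.false_of_typeVector_of_integral_eq_zero_of_cells` wants, for every representative `r` of the cell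
family, the letter `hwit`: `∃ b₀ ∈ B, ∃ hb₀H : r b₀ r⁻¹ ∈ H, θ b₀ ≠ τ ⟨r b₀ r⁻¹, hb₀H⟩ 1` (`B = J_{m+1}`, `H = P`, `τ = ((1 ⊗ (χ₁, 1)) ∘ proj) ⊗ δ^{1∕2}` the inducing representation
of `i(χ₁, 1)`, `θ(g) = if h : IsUnit g₀₀ then χ₁(h.unit) else 0`).  For `r = w₀` (and the big cell `|z| ≥ 1`, ★ p861613) this is the TORUS witness ★ Z2A-3c (ii)
`exists_torusWitness`; THIS FILE supplies it on the INTERMEDIATE cells: `r ∈ N̄ = N.map (conj w₀)` with `|(eA r)₂₀|_w < 1` and `r ∉ J_{m+1}`.  At the one place `w ∣ v`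
(`v` non-split) `eA r = ū(x, z)` (★ Z2A-3a `exists_coe_eq_lower_of_mem_map`, ★ Z2A-3b `map_mem_map_of_mem_map`), and ★ §10 (a) `K2E3LevelNDepthWitnessCover.exists_depth_witness_of_not_mem`
(families X ★ p862033 ∪ Z ★ p861978) gives `u ∈ N_w` with `j := ū⁻¹ u ū ∈ J_{m+1}` and `j₀₀ = (1 + c)(1 + ε)`, `|ε|_w ≤ |ϖ|^{m+1}`, for the `σ_w`-fixed `c := (u₁)_w − 1 ∈ 𝔭ᵐ`
read off the EXACT-CONDUCTOR letter `u₁` (a `σ`-fixed unit of `L ⊗ L⁺_v`, `≡ 1 mod 𝔭ᵐ`, with `χ₁ u₁ ≠ 1`: cond(`χ₁|_{F^×}`) = `m + 1`).  Put `b₀ := r⁻¹ · eA⁻¹(u) · r`: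
then `eA b₀ = j` so `b₀ ∈ J_{m+1}` (the comap letters `hK0 hJn`); `r b₀ r⁻¹ = eA⁻¹(u) ∈ N ⊆ P` (§1 `symm_mem_N_of_mem_unipotentU`), where `τ(·)·1 = δ^{1∕2}(·)·χ(proj ·) = 1`
(★ `twist_comp_proj_apply_one`, ★ `rootDeltaChar_cmBorel_eq_one`, ★ `ParabolicTriple.proj_apply_of_mem_N`); and `θ(b₀) = χ₁(unit (b₀)₀₀)` with `((b₀)₀₀)_w = j₀₀ = (u₁)_w(1 + ε)`
(★ `coe_eA_apply`), so `unit (b₀)₀₀ = u₁ · e` with `|e_{w′} − 1| ≤ |ϖ|^{m+1}` at the one place, `χ₁ e = 1` by the CONDUCTOR letter `hcond` (★ p861880's shape verbatim), and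
`θ(b₀) = χ₁ u₁ ≠ 1`.
* §1 transport: `symm_mem_N_of_mem_unipotentU` (`eA⁻¹(N_w) ⊆ N`), `not_mem_model_of_not_mem` (`r ∉ J_{m+1} ⟹ eA r ∉` the place-model `J_{m+1}`), `symm_mem_of_mem_model` (converse direction).
* §2 the inducing representation on `N`: `tau_apply_one_eq_one_of_mem_N`.
* §3 **`exists_depthWitness_of_mem_map_of_not_mem`** (the letter `hwit` on an intermediate cell).
HONEST LABEL: HC_CM is proved only modulo the 7 printed citations (2 remaining named inputs: hLiu418 = stmt-HodgeConjecture-24832, h413 = stmt-HodgeConjecture-24833)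
until rung 0 closes; count-neutral — this file does NOT pay the leaf; no printed citation is discharged.

## References
* [Roche1998] A. Roche, *Types and Hecke algebras for principal series representations of split reductive p-adic groups*, Ann. Sci. ÉNS (4) 31 (1998), §3–§4 (support of
  `χ̃`-spherical vectors: the cell `P g J` supports one iff `χ̃ = ᵍχ` on `J ∩ g⁻¹Pg`).
* [Casselman1995] W. Casselman, *Introduction to the theory of admissible representations of `p`-adic reductive groups* (1995), §6.3–§6.4.
* [Rogawski1990] J. D. Rogawski, *Automorphic Representations of Unitary Groups in Three Variables*, Ann. of Math. Stud. 123 (1990), §1.9–§1.10 pp. 8–9, §12.1 p. 171.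
* [MoyPrasad1996] A. Moy, G. Prasad, *Jacquet functors and unrefined minimal K-types*, Comment. Math. Helv. 71 (1996), §3.
* [PlatonovRapinchuk1994] V. Platonov, A. Rapinchuk, *Algebraic Groups and Number Theory* (1994), §5.1 (one place above a non-split `v`).
* [BernsteinZelevinsky1977] I. N. Bernstein, A. V. Zelevinsky, Ann. Sci. ÉNS 10 (1977), §1.8 (`δ` on `N`, the Levi projection).
-/

set_option autoImplicit false
-- the mandated namespace has the single-problem summit's repeated segment (`HodgeConjecture.HodgeConjecture`)
set_option linter.dupNamespace false

noncomputable section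

open NumberField IsDedekindDomain
open scoped Matrix MatrixGroups WithZero Valued
open Literature.NumberTheory Literature.NumberTheory.Automorphic Literature.NumberTheory.Automorphic.UnitaryGroup
open Literature.NumberTheory.Rogawski1990

namespace Summit.HodgeConjecture.HodgeConjecture.Cruxes.H413.K2E3LevelNDepthWitnessCM

open Summit.HodgeConjecture.HodgeConjecture.Cruxes.H413
open Summit.HodgeConjecture.HodgeConjecture.Cruxes.H413.K2E3DepthZeroIwahoriCharacterCM
open Summit.HodgeConjecture.HodgeConjecture.Cruxes.H413.K2E3LevelNIwahoriCharacterCM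
open Summit.HodgeConjecture.HodgeConjecture.Cruxes.H413.K2E3BranchATorusWitnessCM

variable (L : Type) [Field L] [NumberField L] [IsCMField L] (v : HeightOneSpectrum (𝓞 ↥(maximalRealSubfield L)))
  (w : PlacesOver L v) (hw : IsCMField.complexConj L • w.1 = w.1)
  (eA : Gqs L v ≃ₜ* ↥(unitaryGroupOfForm (galAdicCompletionMap (L := L) (IsCMField.complexConj L) hw) ((StdForm.antidiagonal 3).over (w.1.adicCompletion L))))
  (heA : ∀ g : Gqs L v,
    ((eA g : ↥(unitaryGroupOfForm (galAdicCompletionMap (L := L) (IsCMField.complexConj L) hw) ((StdForm.antidiagonal 3).over (w.1.adicCompletion L)))) :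
        GL (Fin 3) (w.1.adicCompletion L)) =
      ((localNonsplitEquiv (IsCMField.complexConj L) (qsForm L) (IsCMField.complexConj_ne_one L) w hw g :
        ↥(unitaryGroupOfForm (galAdicCompletionMap (L := L) (IsCMField.complexConj L) hw) (placeForm (qsForm L) w.1))) : GL (Fin 3) (w.1.adicCompletion L)))
  {ϖ : w.1.adicCompletion L} (hϖ : Valued.v ϖ = WithZero.exp (-1 : ℤ))
  (K0 : Subgroup (Gqs L v))
  (hK0 : K0 = ((glInt 3 (w.1.adicCompletion L)).subgroupOf
    (unitaryGroupOfForm (galAdicCompletionMap (L := L) (IsCMField.complexConj L) hw) ((StdForm.antidiagonal 3).over (w.1.adicCompletion L)))).comap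
      eA.toMulEquiv.toMonoidHom)
  {m : ℕ} (gn : GL (Fin 3) (w.1.adicCompletion L))
  (hgn : (gn : Matrix (Fin 3) (Fin 3) (w.1.adicCompletion L)) = Matrix.diagonal ![(1 : w.1.adicCompletion L), 1, ϖ ^ (m + 1)])
  (Jn : Subgroup (Gqs L v))
  (hJn : Jn = K0 ⊓ (((glInt 3 (w.1.adicCompletion L)).map (MulAut.conj gn).toMonoidHom).subgroupOf
    (unitaryGroupOfForm (galAdicCompletionMap (L := L) (IsCMField.complexConj L) hw) ((StdForm.antidiagonal 3).over (w.1.adicCompletion L)))).comap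
      eA.toMulEquiv.toMonoidHom)
  (w₀ : Gqs L v) (hw₀ : Units.val (w₀.val : GL (Fin 3) (LocalRing L v)) = cmLocalForm L 3 v)

/-! ## §1 Transport along `eA`: `N`, and the level-`(m+1)` Iwahori -/

include hw heA in
/-- **`eA⁻¹` of an upper unitriangular element of the place model lies in `N(L⁺_v)`** (entries read at the one place `w`; converse of ★ Z2A-3b `map_mem_unipotentU_of_mem`).
[cite: Rogawski1990, §1.10 p. 9] [cite: PlatonovRapinchuk1994, §5.1] -/
theorem symm_mem_N_of_mem_unipotentU
    {u : ↥(unitaryGroupOfForm (galAdicCompletionMap (L := L) (IsCMField.complexConj L) hw) ((StdForm.antidiagonal 3).over (w.1.adicCompletion L)))}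
    (hu : u ∈ unipotentU (galAdicCompletionMap (L := L) (IsCMField.complexConj L) hw) ((StdForm.antidiagonal 3).over (w.1.adicCompletion L))) :
    ((eA.symm u : Gqs L v) : ↥(unitaryGroupOfForm (conjLocal L (IsCMField.complexConj L) v) (cmLocalForm L 3 v))) ∈ (cmBorelTriple L 3 v).N := by
  obtain ⟨htri, hdiag⟩ := (mem_unipotentU_iff u).1 hu
  refine (mem_unipotentU_iff (σ := conjLocal L (IsCMField.complexConj L) v) (J := cmLocalForm L 3 v)
    (show ↥(unitaryGroupOfForm (conjLocal L (IsCMField.complexConj L) v) (cmLocalForm L 3 v)) from eA.symm u)).2 ⟨fun i j hij => ?_, fun i => ?_⟩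
  · have e : ((((eA.symm u).val : GL (Fin 3) (LocalRing L v)) : Matrix (Fin 3) (Fin 3) (LocalRing L v)) i j) = 0 := by
      rw [LocalRing.eq_iff_apply_eq (IsCMField.complexConj L) (IsCMField.complexConj_ne_one L) w hw, ← coe_eA_apply L v w hw eA heA (eA.symm u) i j,
        ContinuousMulEquiv.apply_symm_apply, Pi.zero_apply]
      exact htri hij
    exact e
  · have e : ((((eA.symm u).val : GL (Fin 3) (LocalRing L v)) : Matrix (Fin 3) (Fin 3) (LocalRing L v)) i i) = 1 := by
      rw [LocalRing.eq_iff_apply_eq (IsCMField.complexConj L) (IsCMField.complexConj_ne_one L) w hw, ← coe_eA_apply L v w hw eA heA (eA.symm u) i i,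
        ContinuousMulEquiv.apply_symm_apply, Pi.one_apply]
      exact hdiag i
    exact e

include hK0 hJn in
/-- `r ∉ J_{m+1} = K0 ⊓ eA⁻¹(g K₀ g⁻¹ ∩ U_w)` ⟹ `eA r ∉` the place-model `J_{m+1} = (GL₃(𝒪) ∩ U_w) ⊓ (g GL₃(𝒪) g⁻¹ ∩ U_w)` (contrapositive of the comap letters).
[cite: BruhatTits1972, (4.4.4)] -/
theorem not_mem_model_of_not_mem {r : Gqs L v} (hr : r ∉ Jn) :
    eA r ∉ (glInt 3 (w.1.adicCompletion L)).subgroupOf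
        (unitaryGroupOfForm (galAdicCompletionMap (L := L) (IsCMField.complexConj L) hw) ((StdForm.antidiagonal 3).over (w.1.adicCompletion L))) ⊓
      ((glInt 3 (w.1.adicCompletion L)).map (MulAut.conj gn).toMonoidHom).subgroupOf
        (unitaryGroupOfForm (galAdicCompletionMap (L := L) (IsCMField.complexConj L) hw) ((StdForm.antidiagonal 3).over (w.1.adicCompletion L))) := by
  intro h
  apply hr
  subst hJn hK0
  exact Subgroup.mem_inf.2 ⟨(Subgroup.mem_inf.1 h).1, (Subgroup.mem_inf.1 h).2⟩

include hK0 hJn in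
/-- `eA⁻¹` of an element of the place-model `J_{m+1}` lies in `J_{m+1}` (the comap letters `hK0 hJn`). [cite: BruhatTits1972, (4.4.4)] -/
theorem symm_mem_of_mem_model
    {κ : ↥(unitaryGroupOfForm (galAdicCompletionMap (L := L) (IsCMField.complexConj L) hw) ((StdForm.antidiagonal 3).over (w.1.adicCompletion L)))}
    (hκ : κ ∈ (glInt 3 (w.1.adicCompletion L)).subgroupOf
        (unitaryGroupOfForm (galAdicCompletionMap (L := L) (IsCMField.complexConj L) hw) ((StdForm.antidiagonal 3).over (w.1.adicCompletion L))) ⊓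
      ((glInt 3 (w.1.adicCompletion L)).map (MulAut.conj gn).toMonoidHom).subgroupOf
        (unitaryGroupOfForm (galAdicCompletionMap (L := L) (IsCMField.complexConj L) hw) ((StdForm.antidiagonal 3).over (w.1.adicCompletion L)))) :
    eA.symm κ ∈ Jn := by
  subst hJn hK0
  obtain ⟨h1, h2⟩ := Subgroup.mem_inf.1 hκ
  rw [← eA.apply_symm_apply κ] at h1 h2
  exact Subgroup.mem_inf.2 ⟨h1, h2⟩

/-! ## §2 The inducing representation of `i(χ₁, 1)` is trivial on `N(L⁺_v)` -/

/-- **`(((1 ⊗ (χ₁, 1)) ∘ proj) ⊗ δ^{1∕2})(u)·1 = 1` for `u ∈ N(L⁺_v)`**: the value is `δ^{1∕2}(u)·χ(proj u)` (★ `twist_comp_proj_apply_one`), `δ^{1∕2}(u) = 1` (★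
`rootDeltaChar_cmBorel_eq_one`) and `proj u = 1` (★ `ParabolicTriple.proj_apply_of_mem_N`). [cite: BernsteinZelevinsky1977, §1.8] [cite: Rogawski1990, §12.1 p. 171] -/
theorem tau_apply_one_eq_one_of_mem_N (χ₁ : (LocalRing L v)ˣ →* ℂˣ)
    {u : ↥(unitaryGroupOfForm (conjLocal L (IsCMField.complexConj L) v) (cmLocalForm L 3 v))} (hu : u ∈ (cmBorelTriple L 3 v).N)
    (huP : u ∈ (cmBorelTriple L 3 v).P) :
    (haveI := locallyCompactSpace_cmBorelU L 3 v
     (Representation.twist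
        (((Representation.trivial ℂ ↥(torusU (conjLocal L (IsCMField.complexConj L) v) (cmLocalForm L 3 v)) ℂ).twist
          (cmTorusCharPair L v χ₁ 1)).comp (cmBorelTriple L 3 v).proj) (rootDeltaChar (cmBorelTriple L 3 v).P)) ⟨u, huP⟩ 1) = 1 := by
  haveI := locallyCompactSpace_cmBorelU L 3 v
  rw [twist_comp_proj_apply_one (cmBorelTriple L 3 v) (cmTorusCharPair L v χ₁ 1) (rootDeltaChar (cmBorelTriple L 3 v).P) ⟨u, huP⟩,
    F0P2nBorelCharactersUnipotent.rootDeltaChar_cmBorel_eq_one L v u hu, ParabolicTriple.proj_apply_of_mem_N _ ⟨u, huP⟩ hu, map_one,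
    Units.val_one, mul_one]

/-! ## §3 The depth witness on an intermediate cell -/

open Classical in
include hw heA hϖ hK0 hgn hJn hw₀ in
set_option maxHeartbeats 1600000 in
-- the `U(Φ₃)(L⁺_v)`-valued products are read in two definitionally equal carriers (`Gqs L v` and the matrix subgroup); unification is slow
/-- **THE LETTER `hwit` ON AN INTERMEDIATE CELL (programme A_pos^{=}, CM dress of ★ p861978 ∕ ★ p862033 via ★ §10 (a)).**  Frame: `v` non-split, `w ∣ v`, `eA`, a uniformiser `ϖ`,
`K0 = eA⁻¹(GL₃(𝒪) ∩ U_w)`, `g = diag(1, 1, ϖ^{m+1})`, `J_{m+1} = K0 ⊓ eA⁻¹(g GL₃(𝒪) g⁻¹ ∩ U_w)`, `w₀` of matrix `Φ₃`; `1 ≤ m`; `|2|_w = 1`.  Letters: `χ₁ : (L ⊗ L⁺_v)ˣ → ℂˣ` of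
CONDUCTOR `≤ m + 1` (`hcond`: `χ₁ u = 1` whenever `|u_{w′} − 1| ≤ |ϖ|^{m+1}` for all `w′ ∣ v` — ★ p861880's shape verbatim) and an EXACT-CONDUCTOR witness `u₁` (a unit with
`σ u₁ = u₁`, `|(u₁)_{w′} − 1| ≤ |ϖ|ᵐ`, `χ₁ u₁ ≠ 1`: cond(`χ₁|_{F^×}`) = `m + 1`, sub-case A_pos^{=}).  Then every `r ∈ N̄ = N.map (conj w₀)` with `|(eA r)₂₀|_w < 1` (off the big
cell) and `r ∉ J_{m+1}` carries `b₀ ∈ J_{m+1}` with `r b₀ r⁻¹ ∈ P` and `θ(b₀) ≠ (((1 ⊗ (χ₁, 1)) ∘ proj) ⊗ δ^{1∕2})(r b₀ r⁻¹)·1` for `θ(g) = if h : IsUnit g₀₀ then χ₁(h.unit) else 0`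
— indeed `θ(b₀) = χ₁ u₁ ≠ 1` while the right-hand side is `1` (`r b₀ r⁻¹ ∈ N`).  With ★ Z2A-3c (ii) `exists_torusWitness` (the representative `w₀`, transported over the big cell
★ p861613) this is the whole letter `hwit` of ★ p861573 for the cell family `{w₀} ∪ (N̄ ∖ J_{m+1} ∖ big cell)`.
[cite: Roche1998, §4] [cite: Casselman1995, §6.3] [cite: Rogawski1990, §1.10 p. 9] [cite: Rogawski1990, §12.1 p. 171] [cite: MoyPrasad1996, §3] -/
theorem exists_depthWitness_of_mem_map_of_not_mem (hm : 1 ≤ m) (h2 : Valued.v (2 : w.1.adicCompletion L) = 1)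
    (χ₁ : (LocalRing L v)ˣ →* ℂˣ)
    (hcond : ∀ u : (LocalRing L v)ˣ, (∀ w' : PlacesOver L v, Valued.v (((u : LocalRing L v) w') - 1) ≤ Valued.v ϖ ^ (m + 1)) → χ₁ u = 1)
    (u₁ : (LocalRing L v)ˣ) (hσu₁ : Units.map (conjLocal L (IsCMField.complexConj L) v : LocalRing L v →* LocalRing L v) u₁ = u₁)
    (hu₁ : ∀ w' : PlacesOver L v, Valued.v (((u₁ : LocalRing L v) w') - 1) ≤ Valued.v ϖ ^ m) (hχu₁ : χ₁ u₁ ≠ 1)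
    {r : Gqs L v} (hr : r ∈ ((cmBorelTriple L 3 v).N).map (MulAut.conj w₀).toMonoidHom)
    (hz : Valued.v ((((eA r : ↥(unitaryGroupOfForm (galAdicCompletionMap (L := L) (IsCMField.complexConj L) hw) ((StdForm.antidiagonal 3).over (w.1.adicCompletion L)))) :
        GL (Fin 3) (w.1.adicCompletion L)) : Matrix (Fin 3) (Fin 3) (w.1.adicCompletion L)) 2 0) < 1)
    (hoff : r ∉ Jn) :
    ∃ (b₀ : Gqs L v) (hb₀P : ((r * b₀ * r⁻¹ : Gqs L v) : ↥(unitaryGroupOfForm (conjLocal L (IsCMField.complexConj L) v) (cmLocalForm L 3 v))) ∈ (cmBorelTriple L 3 v).P),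
      b₀ ∈ Jn ∧
      (if h : IsUnit (((b₀.val : GL (Fin 3) (LocalRing L v)) : Matrix (Fin 3) (Fin 3) (LocalRing L v)) 0 0) then ((χ₁ h.unit : ℂˣ) : ℂ) else 0) ≠
        (haveI := locallyCompactSpace_cmBorelU L 3 v
         (Representation.twist
            (((Representation.trivial ℂ ↥(torusU (conjLocal L (IsCMField.complexConj L) v) (cmLocalForm L 3 v)) ℂ).twist
              (cmTorusCharPair L v χ₁ 1)).comp (cmBorelTriple L 3 v).proj) (rootDeltaChar (cmBorelTriple L 3 v).P))
          ⟨((r * b₀ * r⁻¹ : Gqs L v) : ↥(unitaryGroupOfForm (conjLocal L (IsCMField.complexConj L) v) (cmLocalForm L 3 v))), hb₀P⟩ 1) := by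
  haveI := locallyCompactSpace_cmBorelU L 3 v
  have hσσ : ∀ x, (galAdicCompletionMap (L := L) (IsCMField.complexConj L) hw) ((galAdicCompletionMap (L := L) (IsCMField.complexConj L) hw) x) = x :=
    galAdicCompletionMap_galAdicCompletionMap_of_smul_eq (IsCMField.complexConj L) w (IsCMField.complexConj_ne_one L) hw
  have hvσ : ∀ x, Valued.v (galAdicCompletionMap (L := L) (IsCMField.complexConj L) hw x) = Valued.v x :=
    fun x => valued_galAdicCompletionMap (L := L) (IsCMField.complexConj L) hw x
  -- the representative in the place model: `eA r = ū(x, z)`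
  have hrw := map_mem_map_of_mem_map L v w hw eA heA (cmBorelTriple L 3 v) rfl w₀ hw₀ hr
  obtain ⟨x, z, hnb, hrel⟩ := K2E3LowerUnipotentBorelIwahori.exists_coe_eq_lower_of_mem_map _ rfl hσσ hrw
  have hz' : Valued.v z < 1 := by
    have e : (((eA r : ↥(unitaryGroupOfForm (galAdicCompletionMap (L := L) (IsCMField.complexConj L) hw) ((StdForm.antidiagonal 3).over (w.1.adicCompletion L)))) :
        GL (Fin 3) (w.1.adicCompletion L)) : Matrix (Fin 3) (Fin 3) (w.1.adicCompletion L)) 2 0 = z := by rw [hnb]; rfl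
    rw [← e]; exact hz
  -- the `σ_w`-fixed element `c = (u₁)_w − 1 ∈ 𝔭ᵐ`
  set c : w.1.adicCompletion L := (u₁ : LocalRing L v) w - 1 with hc_def
  have hσc : galAdicCompletionMap (L := L) (IsCMField.complexConj L) hw c = c := by
    have h1 : galAdicCompletionMap (L := L) (IsCMField.complexConj L) hw ((u₁ : LocalRing L v) w) = (u₁ : LocalRing L v) w := by
      rw [← conjLocal_apply_eq_of_smul_eq (IsCMField.complexConj L) (IsCMField.complexConj_ne_one L) v w hw (u₁ : LocalRing L v)]
      have h := congrArg (fun x : (LocalRing L v)ˣ => (x : LocalRing L v) w) hσu₁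
      simpa only [Units.coe_map, MonoidHom.coe_coe] using h
    rw [hc_def, map_sub, map_one, h1]
  have hc : Valued.v c ≤ Valued.v ϖ ^ m := hu₁ w
  -- ★ §10 (a): the model witness `u ∈ N_w`, `j = ū⁻¹ u ū ∈ J_{m+1}`, `j₀₀ = (1 + c)(1 + ε)`
  obtain ⟨u, huN, hj, ε, hε, h00⟩ := K2E3LevelNDepthWitnessCover.exists_depth_witness_of_not_mem _ rfl hσσ hvσ hϖ gn hgn hm hnb hrel hz'
    (not_mem_model_of_not_mem L v w hw eA K0 hK0 gn Jn hJn hoff) hσc hc h2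
  -- `b₀ := r⁻¹ · eA⁻¹(u) · r`, `eA b₀ = j`, `r b₀ r⁻¹ = eA⁻¹(u)`
  refine ⟨r⁻¹ * eA.symm u * r, ?_, ?_, ?_⟩
  · have e : r * (r⁻¹ * eA.symm u * r) * r⁻¹ = eA.symm u := by group
    rw [e]
    exact (cmBorelTriple L 3 v).N_le (symm_mem_N_of_mem_unipotentU L v w hw eA heA huN)
  · have e : r⁻¹ * eA.symm u * r = eA.symm ((eA r)⁻¹ * u * eA r) := by
      apply eA.injective
      rw [ContinuousMulEquiv.apply_symm_apply, map_mul, map_mul, map_inv, ContinuousMulEquiv.apply_symm_apply]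
    rw [e]
    exact symm_mem_of_mem_model L v w hw eA K0 hK0 gn Jn hJn hj
  · -- right-hand side `= 1`
    have hN : ((r * (r⁻¹ * eA.symm u * r) * r⁻¹ : Gqs L v) : ↥(unitaryGroupOfForm (conjLocal L (IsCMField.complexConj L) v) (cmLocalForm L 3 v))) ∈
        (cmBorelTriple L 3 v).N := by
      have e : r * (r⁻¹ * eA.symm u * r) * r⁻¹ = eA.symm u := by group
      rw [e]
      exact symm_mem_N_of_mem_unipotentU L v w hw eA heA huN
    rw [tau_apply_one_eq_one_of_mem_N L v χ₁ hN]
    -- left-hand side `= χ₁ u₁`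
    have hb₀J : r⁻¹ * eA.symm u * r ∈ Jn := by
      have e : r⁻¹ * eA.symm u * r = eA.symm ((eA r)⁻¹ * u * eA r) := by
        apply eA.injective
        rw [ContinuousMulEquiv.apply_symm_apply, map_mul, map_mul, map_inv, ContinuousMulEquiv.apply_symm_apply]
      rw [e]
      exact symm_mem_of_mem_model L v w hw eA K0 hK0 gn Jn hJn hj
    have hU := isUnit_apply_zero_zero_of_mem_pow L v w hw eA heA hϖ K0 hK0 gn hgn Jn hJn (by omega) hb₀J
    rw [dif_pos hU]
    -- the `w`-component of `(b₀)₀₀` is `j₀₀ = (u₁)_w (1 + ε)`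
    have h00w : (((r⁻¹ * eA.symm u * r).val : GL (Fin 3) (LocalRing L v)) : Matrix (Fin 3) (Fin 3) (LocalRing L v)) 0 0 w =
        (u₁ : LocalRing L v) w * (1 + ε) := by
      rw [← coe_eA_apply L v w hw eA heA (r⁻¹ * eA.symm u * r) 0 0, map_mul, map_mul, map_inv, ContinuousMulEquiv.apply_symm_apply, h00, hc_def,
        add_sub_cancel]
    -- `e := unit (b₀)₀₀ · u₁⁻¹` is `≡ 1 mod 𝔭^{m+1}` at every place, hence killed by `χ₁`
    have hu₁w : Valued.v ((u₁ : LocalRing L v) w) = 1 := by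
      have hlt : Valued.v c < Valued.v (1 : w.1.adicCompletion L) := by
        rw [Valuation.map_one]
        refine lt_of_le_of_lt hc (pow_lt_one' ?_ (Nat.one_le_iff_ne_zero.1 hm))
        rw [hϖ, ← WithZero.exp_zero, WithZero.exp_lt_exp]; norm_num
      have e : (u₁ : LocalRing L v) w = 1 + c := by rw [hc_def, add_sub_cancel]
      rw [e, Valuation.map_add_eq_of_lt_left _ hlt, Valuation.map_one]
    have hu₁w0 : (u₁ : LocalRing L v) w ≠ 0 := fun h => by rw [h, map_zero] at hu₁w; exact zero_ne_one hu₁w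
    have he : ∀ w' : PlacesOver L v, Valued.v ((((hU.unit * u₁⁻¹ : (LocalRing L v)ˣ)) : LocalRing L v) w' - 1) ≤ Valued.v ϖ ^ (m + 1) := by
      intro w'
      obtain rfl := (PlacesOver.eq_of_smul_eq (IsCMField.complexConj L) (IsCMField.complexConj_ne_one L) w hw w').symm
      rw [Units.val_mul, Units.val_inv_eq_inv_val, Pi.mul_apply, Pi.inv_apply, IsUnit.unit_spec, h00w,
        show (u₁ : LocalRing L v) w * (1 + ε) * ((u₁ : LocalRing L v) w)⁻¹ - 1 = ε by field_simp; ring]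
      exact hε
    have hχe := hcond _ he
    have hunit : hU.unit = (hU.unit * u₁⁻¹) * u₁ := by rw [inv_mul_cancel_right]
    rw [hunit, map_mul, hχe, one_mul]
    intro heq
    exact hχu₁ (Units.val_eq_one.1 heq)

end Summit.HodgeConjecture.HodgeConjecture.Cruxes.H413.K2E3LevelNDepthWitnessCM

end
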